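import Summits.CriticalPhenomena.PercolationContinuityZ3.Theorems.Transplant.CayleyCylinderKitBox
import Summits.CriticalPhenomena.PercolationContinuityZ3.Theorems.Transplant.CayleyCylinderCycle
import HarnessLib

/-!
# Cylinders of a Cayley-graph skeleton X — the cycle kit of the thick frame and its zone radius

builds on p205010 (kernel theorem, internal audit signed; external expert review pending) — nothing in this file uses p205010.
Lane `prim-bschramm`, seat `prim-bschramm-p4` gen 11 (PART C3 of `P4-GENERAL.md`, "thick frames").  Helper file
(`--supports stmt-CriticalPhenomena-4575 --as helper`).

For `E : CylData₂ Γ S`, `L = ℓ + 2r + 1`, `H = Cay(Γ;S)[V_L]`, enhancement class `E′ = Eenh ℓ` (edges of `H` not inside `‖φ‖_∞ ≤ ℓ`) and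
an `H`-edge `{x,y}` inside the small cylinder with `y ≠ x s₀⁻¹`: **`kit`** — the `SubLoc.CycleKit H E′ x y` made of the column of `x` down to
the floor, the thick frame of file IX (floor, wall, excursion through a kernel walk inside `‖φ‖_∞ ≤ r` placed in the corner block
`[ℓ+1, L]²`, ceiling) and the column of `y`.  Every frame vertex is outside the small cylinder, so the frame meets the columns only at
their ends and all its edges are enhancement edges — with NO sign choice and NO condition on `ℓ`.  The kit lies in the ball of radius
`R ℓ = 10L + Kmax ℓ + 1` about `x` (`kit_Z_subset`; `Kmax` bounds the kernel walks of the finitely many kernel elements that can close a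
frame at level `ℓ`); the columns are `s₀`-strings, constant for the column class `cls`.
-/

noncomputable section

namespace Summit.CriticalPhenomena.PercolationContinuityZ3.Theorems.Transplant

namespace CayCyl

open SimpleGraph Walk SubLoc Literature.Probability.LatticeModels Literature.Probability.Percolation
open Literature.Barriers.CriticalPhenomena (graphBall graphBall_mono mem_graphBall_self graphBall_finite)
open scoped Classical

variable {Γ : Type} [Group Γ] {S : Finset Γ}

namespace CylData₂

variable (E : CylData₂ Γ S)

/-! ## §1 The kit -/

section Kit

variable {ℓ : ℕ} (x y : E.enl.V (ℓ + 2 * E.r + 1))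

/-- **The enhancement class**: edges of the big cylinder graph `H_L` not inside the small cylinder `‖φ‖_∞ ≤ ℓ`. [folklore] -/
def Eenh (ℓ : ℕ) : Set (Sym2 (E.enl.V (ℓ + 2 * E.r + 1))) :=
  {d | d ∈ (E.cylG (ℓ + 2 * E.r + 1)).edgeSet ∧ ¬ ∀ z ∈ d, E.φ z.1 ∈ box 2 ℓ}

/-- **THE CYCLE KIT of an edge `{x, y}` of the small cylinder with the thick frame** (`y ≠ x s₀⁻¹`). [cite: BalisterBollobasRiordan2014, §"bond percolation" p. 13] -/
def kit (hx : E.φ x.1 ∈ box 2 ℓ) (hy : E.φ y.1 ∈ box 2 ℓ) (hadj : (E.cylG (ℓ + 2 * E.r + 1)).Adj x y)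
    (hne : y.1 ≠ x.1 * E.enl.s₀⁻¹) : CycleKit (E.cylG (ℓ + 2 * E.r + 1)) (E.Eenh ℓ) x y where
  p := E.enl.pV x
  q := E.enl.qV y
  A := E.colA x
  M := E.pathM x y
  B := E.colB y
  hA := (isPath_induce_iff _ _).2 (isPath_powWalk _ E.enl.s₀inv_pow_injective _ _)
  hM := bypass_isPath _
  hB := ((isPath_induce_iff _ _).2 (isPath_powWalk _ E.enl.s₀_pow_injective _ _)).reverse
  hpq := fun h => by
    have h1 := (E.enl.φ_pt x).1; have h2 := (E.enl.φ_qt y).1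
    have e : E.enl.pt x = E.enl.qt y := congrArg Subtype.val h
    rw [e, h2] at h1; omega
  hxp := fun h => by
    have h1 := (E.enl.φ_pt x).1
    have hx0 := (CylData₁.mem_box_two.1 hx).1; rw [abs_le] at hx0
    have e : x.1 = E.enl.pt x := congrArg Subtype.val h
    rw [← e, enl_φ] at h1; omega
  hqy := fun h => by
    have h1 := (E.enl.φ_qt y).1
    have hy0 := (CylData₁.mem_box_two.1 hy).1; rw [abs_le] at hy0
    have e : E.enl.qt y = y.1 := congrArg Subtype.val h
    rw [e, enl_φ] at h1; omega
  hAM := fun w hwA hwM => by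
    obtain ⟨i, hi, hw⟩ := E.mem_colAE x hwA
    have hfr := (E.frame_mem x y (E.mem_pathME x y hwM)).2
    have hc := E.enl.φ_s₀inv_pow x.1 i
    rw [enl_φ] at hc
    have hxb := CylData₁.mem_box_two.1 hx; rw [abs_le, abs_le] at hxb
    rw [hw, hc.1, hc.2] at hfr
    have hi' : (i : ℤ) ≤ E.enl.nA x := by exact_mod_cast hi
    have e := E.enl.nA_eq x; rw [enl_φ] at e; push_cast at e
    rcases hfr with hfr | hfr | hfr
    · have hinA : i = E.enl.nA x := by omega
      apply Subtype.ext
      rw [hw, hinA]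
    · omega
    · omega
  hMB := fun w hwM hwB => by
    obtain ⟨j, hj, hw⟩ := E.mem_colBE y hwB
    have hfr := (E.frame_mem x y (E.mem_pathME x y hwM)).2
    have hc := E.enl.φ_s₀_pow y.1 j
    rw [enl_φ] at hc
    have hyb := CylData₁.mem_box_two.1 hy; rw [abs_le, abs_le] at hyb
    rw [hw, hc.1, hc.2] at hfr
    have hj' : (j : ℤ) ≤ E.enl.nB y := by exact_mod_cast hj
    have e := E.enl.nB_eq y; rw [enl_φ] at e; push_cast at e
    rcases hfr with hfr | hfr | hfr
    · omega
    · have hjnB : j = E.enl.nB y := by omega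
      apply Subtype.ext
      rw [hw, hjnB]
    · omega
  hAB := fun w hwA hwB => by
    obtain ⟨i, -, hw1⟩ := E.mem_colAE x hwA
    obtain ⟨j, -, hw2⟩ := E.mem_colBE y hwB
    have key : x.1 * E.enl.s₀⁻¹ ^ i = y.1 * E.enl.s₀ ^ j := hw1.symm.trans hw2
    have hG : (mulCayley (S : Set Γ)).Adj x.1 y.1 := hadj
    have hlip := E.enl.lip_adj (E.adj_enl hG) 0
    rw [abs_le, enl_φ] at hlip
    have h0 := congrArg (fun g => E.φ g 0) key
    have hc1 := (E.enl.φ_s₀inv_pow x.1 i).1; have hc2 := (E.enl.φ_s₀_pow y.1 j).1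
    rw [enl_φ] at hc1 hc2
    have h0' : E.φ x.1 0 - i = E.φ y.1 0 + j := by rw [← hc1, ← hc2]; exact h0
    clear h0
    have hij : i + j = 0 ∨ i + j = 1 := by omega
    rcases hij with hij | hij
    · obtain ⟨rfl, rfl⟩ : i = 0 ∧ j = 0 := by omega
      simp only [pow_zero, mul_one] at key
      exact hG.ne key
    · rcases (show (i = 1 ∧ j = 0) ∨ (i = 0 ∧ j = 1) by omega) with ⟨rfl, rfl⟩ | ⟨rfl, rfl⟩
      · simp only [pow_one, pow_zero, mul_one] at key
        exact hne key.symm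
      · simp only [pow_zero, mul_one, pow_one] at key
        exact hne (by rw [key, mul_inv_cancel_right])
  hME := fun d hd => by
    refine ⟨Walk.edges_subset_edgeSet _ hd, fun hall => ?_⟩
    induction d using Sym2.inductionOn with
    | hf a b =>
      have ha : a ∈ (E.pathM x y).support := Walk.fst_mem_support_of_mem_edges _ hd
      exact E.pathM_out x y ha (hall a (Sym2.mem_mk_left _ _))
  hyx := hadj.symm

/-! ## §2 The zone radius -/

/-- The radius within which the closing kernel element of a frame at level `ℓ` lies: `10ℓ + 22r + 11`. [folklore] -/
def ρ (E : CylData₂ Γ S) (ℓ : ℕ) : ℕ := 10 * ℓ + 22 * E.r + 11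

/-- The kernel elements that may close a thick frame at level `ℓ`: the ball of radius `ρ`. [folklore] -/
def kballE (ℓ : ℕ) : Finset Γ := (graphBall_finite (mulCayley (S : Set Γ)) (1 : Γ) (E.ρ ℓ)).toFinset

/-- The uniform bound on the kernel walks of level `ℓ`. [folklore] -/
def Kmax (ℓ : ℕ) : ℕ := (E.kballE ℓ).sup E.boxLen

/-- **The zone radius** `R ℓ = 10L + Kmax ℓ + 1`, `L = ℓ + 2r + 1`. [folklore] -/
def R (ℓ : ℕ) : ℕ := 10 * (ℓ + 2 * E.r + 1) + E.Kmax ℓ + 1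

/-- The four step counts are at most `2L`. [folklore] -/
theorem counts_leE : E.enl.nA x ≤ 2 * (ℓ + 2 * E.r + 1) ∧ E.enl.nB y ≤ 2 * (ℓ + 2 * E.r + 1) ∧
    E.enl.m₁ x ≤ 2 * (ℓ + 2 * E.r + 1) ∧ E.enl.m₂ y ≤ 2 * (ℓ + 2 * E.r + 1) := by
  have hx := E.enl.memV.1 x.2; have hy := E.enl.memV.1 y.2
  rw [abs_le, abs_le] at hx hy
  have e1 := E.enl.nA_eq x; have e2 := E.enl.nB_eq y; have e3 := E.enl.m₁_eq x; have e4 := E.enl.m₂_eq y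
  refine ⟨?_, ?_, ?_, ?_⟩ <;> omega

/-- **The closing kernel element lies in the ball of radius `ρ ℓ`** (back along the wall and the floor, up the column of `x`, across the
edge, up the column of `y`, along `s₁^{m₂} s₀^{−r} s₁^{−r}`). [folklore] -/
theorem kel_mem_kballE (hadj : (E.cylG (ℓ + 2 * E.r + 1)).Adj x y) : E.kel x y ∈ E.kballE ℓ := by
  have hG : (mulCayley (S : Set Γ)).Adj x.1 y.1 := hadj
  have hc := E.counts_leE x y
  let W₁ : (mulCayley (S : Set Γ)).Walk (E.enl.pt x) (E.cc x) :=
    (powWalk S E.adjE_s₁ (E.enl.pt x) (E.enl.m₁ x)).append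
      ((powWalk S E.adjE_s₀ (E.c₁ x) (E.n₀ ℓ)).append (powWalk S E.adjE_s₁_inv (E.c₂ x) E.r))
  let W₂ : (mulCayley (S : Set Γ)).Walk x.1 (E.enl.pt x) := powWalk S E.adjE_s₀_inv x.1 (E.enl.nA x)
  let W₃ : (mulCayley (S : Set Γ)).Walk y.1 (E.enl.qt y * E.enl.s₁ ^ E.enl.m₂ y * E.enl.s₀⁻¹ ^ E.r * E.enl.s₁⁻¹ ^ E.r) :=
    (powWalk S E.adjE_s₀ y.1 (E.enl.nB y)).append
      ((powWalk S E.adjE_s₁ (E.enl.qt y) (E.enl.m₂ y)).append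
        ((powWalk S E.adjE_s₀_inv (E.enl.qt y * E.enl.s₁ ^ E.enl.m₂ y) E.r).append
          (powWalk S E.adjE_s₁_inv (E.enl.qt y * E.enl.s₁ ^ E.enl.m₂ y * E.enl.s₀⁻¹ ^ E.r) E.r)))
  have hend : E.enl.qt y * E.enl.s₁ ^ E.enl.m₂ y * E.enl.s₀⁻¹ ^ E.r * E.enl.s₁⁻¹ ^ E.r = E.cc x * E.kel x y := by
    rw [kel, inv_pow, inv_pow]
    simp only [mul_assoc, mul_inv_cancel_left]
  let W : (mulCayley (S : Set Γ)).Walk (E.cc x) (E.cc x * E.kel x y) :=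
    W₁.reverse.append (W₂.reverse.append (Walk.cons hG (W₃.copy rfl hend)))
  have hn : E.n₀ ℓ = 2 * ℓ + 3 * E.r + 2 := rfl
  have hρ : E.ρ ℓ = 10 * ℓ + 22 * E.r + 11 := rfl
  have hlen : W.length ≤ E.ρ ℓ := by
    simp only [W, W₁, W₂, W₃, Walk.length_append, Walk.length_reverse, Walk.length_cons, Walk.length_copy, length_powWalk]
    omega
  rw [kballE, Set.Finite.mem_toFinset]
  refine ⟨(lmul S (E.cc x)⁻¹ W).copy (inv_mul_cancel _) (by rw [inv_mul_cancel_left]), ?_⟩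
  rw [length_copy, length_lmul]
  exact hlen

/-- The kernel walk of the kit is bounded by `Kmax`. [folklore] -/
theorem boxLen_kel_le (hadj : (E.cylG (ℓ + 2 * E.r + 1)).Adj x y) : E.boxLen (E.kel x y) ≤ E.Kmax ℓ :=
  Finset.le_sup (f := E.boxLen) (E.kel_mem_kballE x y hadj)

/-- The frame path is short: `|M| ≤ 8L + Kmax`. [folklore] -/
theorem length_pathME_le (hadj : (E.cylG (ℓ + 2 * E.r + 1)).Adj x y) :
    (E.pathM x y).length ≤ 8 * (ℓ + 2 * E.r + 1) + E.Kmax ℓ := by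
  refine (length_bypass_le_length _).trans ?_
  rw [length_induce, length_frameE]
  have hc := E.counts_leE x y
  have hk := E.boxLen_kel_le x y hadj
  have hn : E.n₀ ℓ = 2 * ℓ + 3 * E.r + 2 := rfl
  omega

/-- **The whole kit lies in the ball of radius `R ℓ` about `x`.** [folklore] -/
theorem kit_Z_subset (hx : E.φ x.1 ∈ box 2 ℓ) (hy : E.φ y.1 ∈ box 2 ℓ) (hadj : (E.cylG (ℓ + 2 * E.r + 1)).Adj x y)
    (hne : y.1 ≠ x.1 * E.enl.s₀⁻¹) : (E.kit x y hx hy hadj hne).Z ⊆ graphBall (E.cylG (ℓ + 2 * E.r + 1)) x (E.R ℓ) := by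
  have hc := E.counts_leE x y
  have hAB := E.length_cols x y
  have hM := E.length_pathME_le x y hadj
  rintro w (hw | hw | hw)
  · refine ⟨(E.colA x).takeUntil w hw, ?_⟩
    have := (E.colA x).length_takeUntil_le_length hw
    unfold R; omega
  · refine ⟨(E.colA x).append ((E.pathM x y).takeUntil w hw), ?_⟩
    have := (E.pathM x y).length_takeUntil_le_length hw
    rw [Walk.length_append]; unfold R; omega
  · have hw' : w ∈ (E.colB y).reverse.support := (mem_support_reverse_iff _ w).2 hw
    refine ⟨Walk.cons hadj ((E.colB y).reverse.takeUntil w hw'), ?_⟩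
    have := (E.colB y).reverse.length_takeUntil_le_length hw'
    rw [length_reverse] at this
    rw [Walk.length_cons]; unfold R; omega

/-! ## §3 Column classes -/

/-- The column of `x` lies in the class of `x`. [folklore] -/
theorem cls_colAE {w : E.enl.V (ℓ + 2 * E.r + 1)} (hw : w ∈ (E.colA x).support) : E.enl.cls w.1 = E.enl.cls x.1 := by
  obtain ⟨i, -, h⟩ := E.mem_colAE x hw
  rw [h, inv_pow, ← zpow_natCast, ← zpow_neg, E.enl.cls_mul_s₀_zpow]

/-- The column of `y` lies in the class of `y`. [folklore] -/
theorem cls_colBE {w : E.enl.V (ℓ + 2 * E.r + 1)} (hw : w ∈ (E.colB y).support) : E.enl.cls w.1 = E.enl.cls y.1 := by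
  obtain ⟨j, -, h⟩ := E.mem_colBE y hw
  rw [h, ← zpow_natCast, E.enl.cls_mul_s₀_zpow]

end Kit

end CylData₂

end CayCyl

end Summit.CriticalPhenomena.PercolationContinuityZ3.Theorems.Transplant

end
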